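import Summits.BirchSwinnertonDyer.BirchSwinnertonDyer.Theorems.TwoAdicConverseOrdLambdaHalfAtTwoGreenbergGL1PrintOfFacts
import Summits.BirchSwinnertonDyer.BirchSwinnertonDyer.Theorems.TwoAdicConverseOrdLambdaHalfAtTwoWbarStep
import Summits.BirchSwinnertonDyer.BirchSwinnertonDyer.Theorems.TwoAdicConverseOrdLambdaHalfAtTwoGreenbergFieldPackage
import Summits.BirchSwinnertonDyer.BirchSwinnertonDyer.Theorems.TwoAdicConverseOrdLambdaHalfAtTwoTwoTorsionLine
import Summits.BirchSwinnertonDyer.BirchSwinnertonDyer.Theorems.TwoAdicConverseOrdLambdaHalfAtTwoKatoDeterminantDefs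
import Literature.NumberTheory.IwasawaTheory.ClassicalMuVanishesUnramifiedClassesProofs
import Literature.NumberTheory.DiophantineGeometry.LocalReductionFiniteBadPlacesProofs
import HarnessLib

/-!
# Route `TwoAdicConverse` (rung S3), crux `OrdLambdaHalfAtTwo` (item stmt-BirchSwinnertonDyer-19556), line
# `kato-determinant-greenberg-two` (skeleton v4.7 `59b5c9c4a969`): the Greenberg-supply half B2 and the print stub 3b-P
# **modulo Ferrero–Washington ALONE** — and modulo `μ = 0` of the ONE Greenberg field in play

Cell `bsd-2adic`, seat `bsd-2adic-conv-1` GEN 31 (`--supports` stmt-BirchSwinnertonDyer-19556 `--as helper`; the LEAD closes registered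
stubs).  v4.7's print stub `stub_residualGL1PrintFactsAtTwo` is the conjunction [FW] `ferreroWashington1979_classicalMuVanishes` ∧ [DICT]
`classicalMuVanishes_finite_unramifiedClasses`.  [DICT] is now a TREE THEOREM (cell `bsd-potss`, p694611:
`Literature.NumberTheory.IwasawaTheory.ClassicalMuVanishesUnramifiedClasses.classicalMuVanishes_finite_unramifiedClasses_holds`, all `p`,
binder `Odd p ∨ IsTotallyComplex K` — the line's case `p = 2`, `K` imaginary quadratic).  Hence every consumer of the pair (FW, DICT) in the
line is a consumer of FW alone:

* `residualGL1PrintAtTwo_of_FW` — v3.2's `stub_residualGL1PrintAtTwo` ([P1] ∧ [P23], binders verbatim) from FW;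
* `residualGL1FinitenessAtTwo_of_FW` — v2's `stub_residualGL1FinitenessAtTwo` («GL1-res(K)», binders verbatim) from FW (the `w̄`-step is
  the kernel theorem `TwoAdicWbarStep.stub_wbarStepAtTwo`, p672094);
* `greenbergStrictSelmerDual_finite_torsion_mu_on_beta_of_FW` — B2 on (β) (`X_Gr` f.g. `Λ`-torsion, `μ = 0`) from FW;
* `greenbergSupply_of_FW` — the skeleton's `greenbergSupply_of_stubs` (Greenberg field, twist ordinarity, `w ∣ 2`, cyclotomic tower, the two
  duals, B2) from FW.

SHARPER (what the line REALLY consumes of Ferrero–Washington): only `ClassicalMuVanishes κK` for the cyclotomic `ℤ₂`-extension `κK` of the ONE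
imaginary quadratic Greenberg field `K` chosen by `greenbergFieldPackage` — Ferrero's 1980 theorem for imaginary quadratic fields at `p = 2`
(Amer. J. Math. 102; genus theory in the tower, elementary), not the general abelian theorem.  The `_of_classicalMuVanishes` versions display
exactly that hypothesis; `classicalMuVanishes_imaginaryQuadratic_two_of_FW` is the one-line passage FW ⟹ it.

HONEST FRAMING.  Composition; THEOREMS ONLY (no definition, no named fact, no `sorry`); CONDITIONAL on the printed named fact FW (resp. on the
displayed hypothesis `ClassicalMuVanishes κK`); the crux `OrdLambdaHalfAtTwo` is NOT proved here; BSD is not proved by any of this.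
PARTITION (D-0054): none — RANK axis S3 × X5@2 stratum (β); closes none.
-/

set_option linter.dupNamespace false
set_option autoImplicit false

noncomputable section

open scoped Classical

namespace Summit.BirchSwinnertonDyer.BirchSwinnertonDyer.Theorems.TwoAdicGreenbergCotorsion

open NumberField IsDedekindDomain Field WeierstrassCurve
open Literature Literature.NumberTheory.EllipticCurves Literature.NumberTheory.EllipticCurves.GreenbergSelmer
  Literature.NumberTheory.EllipticCurves.GreenbergVatsal2000 Literature.NumberTheory.GaloisRepresentations
  Literature.NumberTheory.IwasawaTheory
  Literature.NumberTheory.IwasawaTheory.ClassicalMuVanishesUnramifiedClasses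
  Literature.NumberTheory.EllipticCurves.Rank1Residual
  Summit.BirchSwinnertonDyer.Rank1Residual.X11b Summit.BirchSwinnertonDyer.Rank1Residual.X11b.AcSelmer
  Summit.BirchSwinnertonDyer.Rank1Residual.X2.ResidualDevissageModules
open Summit.BirchSwinnertonDyer.BirchSwinnertonDyer.Theorems.TwoAdicKatoDeterminant (MK fineData)

/-! ## §1 FW for the Greenberg fields is `μ = 0` of one imaginary quadratic tower -/

/-- **FW ⟹ `μ₂ = 0` for the cyclotomic `ℤ₂`-tower of every imaginary quadratic field** (the only instance of Ferrero–Washington the line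
consumes; an imaginary quadratic field is abelian over `ℚ`).  In print this special case is Ferrero's theorem for imaginary quadratic fields at
`p = 2`. [cite: FerreroWashington1979] [cite: Ferrero1980AJM, Thm. (μ = 0 and the λ-formula for imaginary quadratic fields, p = 2)] [cite: Kida1979Tohoku, Thm. 1] -/
theorem classicalMuVanishes_imaginaryQuadratic_two_of_FW (hFW : ferreroWashington1979_classicalMuVanishes)
    {K : Type} [Field K] [NumberField K] (hK : IsImaginaryQuadratic K) (κ : ZpExtension K 2) (hκ : κ.IsCyclotomic) :
    ClassicalMuVanishes κ := by
  haveI : Fact (Nat.Prime 2) := ⟨Nat.prime_two⟩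
  haveI : IsAbelianGalois ℚ K := isAbelianGalois_of_isImaginaryQuadratic hK
  exact hFW K 2 κ hκ

/-! ## §2 [P1] from `μ = 0` of the tower (DICT discharged) -/

/-- **[P1] ⟸ `μ = 0` of the tower** (DICT is the tree theorem `classicalMuVanishes_finite_unramifiedClasses_holds`): for a totally complex `K`,
a `ℤ₂`-extension `κ` with `ClassicalMuVanishes κ` and a finite discrete `Γ_K`-module `M` of `2`-power order with trivial action, the
everywhere-unramified classes of `H¹(ker κ, M)` form a finite set. [cite: Lang1990, Ch. 5 §4 pp. 137–143] [cite: RaySujatha2021, §1 eq. (1.1)] -/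
theorem finite_unramifiedClasses_of_classicalMuVanishes {K : Type} [Field K] [NumberField K] [IsTotallyComplex K]
    (κ : ZpExtension K 2) (hμ : ClassicalMuVanishes κ)
    (M : Type) [AddCommGroup M] [DistribMulAction (absoluteGaloisGroup K) M] [TopologicalSpace M] [DiscreteTopology M]
    [Finite M] (hM : ∃ k : ℕ, Nat.card M = 2 ^ k) (htriv : ∀ (σ : absoluteGaloisGroup K) (m : M), σ • m = m) :
    {c : Literature.NumberTheory.EllipticCurves.subgroupH1 κ.kerSubgroup M |
      ∀ (v : HeightOneSpectrum (𝓞 K)) (σ : absoluteGaloisGroup K),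
        Literature.NumberTheory.EllipticCurves.conjH1 κ.kerSubgroup M σ c ∈ unramifiedKer κ.kerSubgroup M v}.Finite := by
  haveI : Fact (Nat.Prime 2) := ⟨Nat.prime_two⟩
  exact classicalMuVanishes_finite_unramifiedClasses_holds K 2 κ (Or.inr ‹_›) hμ M hM htriv

/-- **[P1] ⟸ FW alone** for an imaginary quadratic `K` and its cyclotomic `ℤ₂`-extension (DICT discharged by the tree theorem).
[cite: FerreroWashington1979] [cite: Lang1990, Ch. 5 §4 pp. 137–143] -/
theorem finite_unramifiedClasses_of_FW (hFW : ferreroWashington1979_classicalMuVanishes)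
    {K : Type} [Field K] [NumberField K] (hK : IsImaginaryQuadratic K) (κ : ZpExtension K 2) (hκ : κ.IsCyclotomic)
    (M : Type) [AddCommGroup M] [DistribMulAction (absoluteGaloisGroup K) M] [TopologicalSpace M] [DiscreteTopology M]
    [Finite M] (hM : ∃ k : ℕ, Nat.card M = 2 ^ k) (htriv : ∀ (σ : absoluteGaloisGroup K) (m : M), σ • m = m) :
    {c : Literature.NumberTheory.EllipticCurves.subgroupH1 κ.kerSubgroup M |
      ∀ (v : HeightOneSpectrum (𝓞 K)) (σ : absoluteGaloisGroup K),
        Literature.NumberTheory.EllipticCurves.conjH1 κ.kerSubgroup M σ c ∈ unramifiedKer κ.kerSubgroup M v}.Finite :=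
  finite_unramifiedClasses_of_print hFW classicalMuVanishes_finite_unramifiedClasses_holds hK κ hκ M hM htriv

/-! ## §3 v3.2's `stub_residualGL1PrintAtTwo` ([P1] ∧ [P23]) -/

/-- **[P1] ∧ [P23] for ONE tower ⟸ `μ = 0` of that tower**: for an imaginary quadratic `K`, its cyclotomic `ℤ₂`-extension `κK` with
`ClassicalMuVanishes κK`, and any discrete `Γ_K`-module `M` of order `2`: [P1] the everywhere-unramified classes of `H¹(K_∞, M)` form a finite
set and [P23] for every `v ∤ 2`, `H¹(K_∞, M)` modulo the classes unramified above `v` is finite (KERNEL, p663165).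
[cite: Lang1990, Ch. 5 §4 pp. 137–143] [cite: GreenbergVatsal2000, §2 Prop. (2.4)] -/
theorem residualGL1PrintAtTwo_of_classicalMuVanishes {K : Type} [Field K] [NumberField K] (hK : IsImaginaryQuadratic K)
    (κK : ZpExtension K 2) (hκ : κK.IsCyclotomic) (hμ : ClassicalMuVanishes κK)
    (M : Type) [AddCommGroup M] [DistribMulAction (absoluteGaloisGroup K) M] [TopologicalSpace M] [DiscreteTopology M]
    (hM2 : Nat.card M = 2) :
    {c : Literature.NumberTheory.EllipticCurves.subgroupH1 κK.kerSubgroup M |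
        ∀ (v : HeightOneSpectrum (𝓞 K)) (σ : absoluteGaloisGroup K),
        Literature.NumberTheory.EllipticCurves.conjH1 κK.kerSubgroup M σ c ∈ unramifiedKer κK.kerSubgroup M v}.Finite ∧
    ∀ (v : HeightOneSpectrum (𝓞 K)), ((2 : ℕ) : 𝓞 K) ∉ v.asIdeal →
      Finite (Literature.NumberTheory.EllipticCurves.subgroupH1 κK.kerSubgroup M ⧸
        ⨅ σ : absoluteGaloisGroup K, (unramifiedKer κK.kerSubgroup M v).comap
          (Literature.NumberTheory.EllipticCurves.conjH1 κK.kerSubgroup M σ)) := by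
  haveI : Fact (Nat.Prime 2) := ⟨Nat.prime_two⟩
  haveI : Finite M := Nat.finite_of_card_ne_zero (by rw [hM2]; norm_num)
  haveI : IsTotallyComplex K := hK.isTotallyComplex
  have hM : ∃ k : ℕ, Nat.card M = 2 ^ k := ⟨1, by rw [hM2, pow_one]⟩
  have htriv : ∀ (σ : absoluteGaloisGroup K) (m : M), σ • m = m := fun σ m ↦ smul_eq_self_of_natCard_eq_two hM2 σ m
  exact ⟨finite_unramifiedClasses_of_classicalMuVanishes κK hμ M hM htriv,
    fun v hpv ↦ finite_quotient_iInf_unramifiedKer_of_not_decomp_le κK M hM htriv hpv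
      (not_decomp_le_kerSubgroup_of_isCyclotomic κK hκ v)⟩

/-- **v3.2's `stub_residualGL1PrintAtTwo` ⟸ FW ALONE** (binders of the registered statement verbatim; DICT discharged).  If the lead re-types
the print stub `stub_residualGL1PrintFactsAtTwo` as FW alone, the in-file close of `residualGL1PrintAtTwo` is this theorem applied to it.
[cite: FerreroWashington1979] [cite: Lang1990, Ch. 5 §4 pp. 137–143] [cite: GreenbergVatsal2000, §2 Prop. (2.4)] -/
theorem residualGL1PrintAtTwo_of_FW (hFW : ferreroWashington1979_classicalMuVanishes) :
    ∀ (K : Type) [Field K] [NumberField K], IsImaginaryQuadratic K →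
      ∀ (κK : ZpExtension K 2), κK.IsCyclotomic →
      ∀ (M : Type) [AddCommGroup M] [DistribMulAction (absoluteGaloisGroup K) M]
        [TopologicalSpace M] [DiscreteTopology M], Nat.card M = 2 →
        {c : Literature.NumberTheory.EllipticCurves.subgroupH1 κK.kerSubgroup M |
            ∀ (v : HeightOneSpectrum (𝓞 K)) (σ : absoluteGaloisGroup K),
            Literature.NumberTheory.EllipticCurves.conjH1 κK.kerSubgroup M σ c ∈ unramifiedKer κK.kerSubgroup M v}.Finite ∧
        ∀ (v : HeightOneSpectrum (𝓞 K)), ((2 : ℕ) : 𝓞 K) ∉ v.asIdeal →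
          Finite (Literature.NumberTheory.EllipticCurves.subgroupH1 κK.kerSubgroup M ⧸
            ⨅ σ : absoluteGaloisGroup K, (unramifiedKer κK.kerSubgroup M v).comap
              (Literature.NumberTheory.EllipticCurves.conjH1 κK.kerSubgroup M σ)) :=
  residualGL1PrintAtTwo_of_facts hFW classicalMuVanishes_finite_unramifiedClasses_holds

/-! ## §4 v2's `stub_residualGL1FinitenessAtTwo` («GL1-res(K)») -/

/-- **GL1-res(K) for ONE tower ⟸ `μ = 0` of that tower** (the `w̄`-step is the kernel theorem `TwoAdicWbarStep.stub_wbarStepAtTwo`, the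
reduction is `finite_datumStrictSelmer_bdpData_of_inputs`): for an imaginary quadratic `K`, its cyclotomic `ℤ₂`-extension `κK` with
`ClassicalMuVanishes κK`, `w ∣ 2`, a finite `S` and a discrete `Γ_K`-module `M` of order `2`, the residual Greenberg–Castella Selmer group
`R_w^S(K_∞, M)` is finite. [cite: Lang1990, Ch. 5 §4 pp. 137–143] [cite: JaulentMaire2003, Thm 12 and Example p. 189] -/
theorem residualGL1FinitenessAtTwo_of_classicalMuVanishes {K : Type} [Field K] [NumberField K] (hK : IsImaginaryQuadratic K)
    (κK : ZpExtension K 2) (hκ : κK.IsCyclotomic) (hμ : ClassicalMuVanishes κK)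
    (w : HeightOneSpectrum (𝓞 K)) (hw : ((2 : ℕ) : 𝓞 K) ∈ w.asIdeal)
    (S : Set (HeightOneSpectrum (𝓞 K))) (hS : S.Finite)
    (M : Type) [AddCommGroup M] [DistribMulAction (absoluteGaloisGroup K) M] [TopologicalSpace M] [DiscreteTopology M]
    (hM2 : Nat.card M = 2) :
    (datumStrictSelmer κK.kerSubgroup M 2 (AcSelmer.bdpData M 2 w) S :
      Set (Literature.NumberTheory.EllipticCurves.subgroupH1 κK.kerSubgroup M)).Finite := by
  haveI : Fact (Nat.Prime 2) := ⟨Nat.prime_two⟩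
  obtain ⟨hP1, hP23⟩ := residualGL1PrintAtTwo_of_classicalMuVanishes hK κK hκ hμ M hM2
  exact finite_datumStrictSelmer_bdpData_of_inputs κK.kerSubgroup M 2 w hw S hS hP1 (fun v _ hv => hP23 v hv)
    (Summit.BirchSwinnertonDyer.BirchSwinnertonDyer.Theorems.TwoAdicWbarStep.stub_wbarStepAtTwo K hK κK hκ w hw M hM2)

/-- **v2's `stub_residualGL1FinitenessAtTwo` ⟸ FW ALONE** (binders of the registered statement verbatim; DICT discharged, `w̄`-step kernel).
[cite: FerreroWashington1979] [cite: JaulentMaire2003, Thm 12 and Example p. 189] -/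
theorem residualGL1FinitenessAtTwo_of_FW (hFW : ferreroWashington1979_classicalMuVanishes) :
    ∀ (K : Type) [Field K] [NumberField K], IsImaginaryQuadratic K →
      ∀ (κK : ZpExtension K 2), κK.IsCyclotomic →
      ∀ (w : HeightOneSpectrum (𝓞 K)), ((2 : ℕ) : 𝓞 K) ∈ w.asIdeal →
      ∀ (S : Set (HeightOneSpectrum (𝓞 K))), S.Finite →
      ∀ (M : Type) [AddCommGroup M] [DistribMulAction (absoluteGaloisGroup K) M]
        [TopologicalSpace M] [DiscreteTopology M], Nat.card M = 2 →
        (datumStrictSelmer κK.kerSubgroup M 2 (AcSelmer.bdpData M 2 w) S :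
          Set (Literature.NumberTheory.EllipticCurves.subgroupH1 κK.kerSubgroup M)).Finite :=
  fun _ _ _ hK κK hκ w hw S hS M _ _ _ _ hM2 ↦
    residualGL1FinitenessAtTwo_of_classicalMuVanishes hK κK hκ (classicalMuVanishes_imaginaryQuadratic_two_of_FW hFW hK κK hκ)
      w hw S hS M hM2

/-! ## §5 B2 on (β) -/

variable (W : WeierstrassCurve ℚ) [W.IsElliptic]

/-- **B2 ON HABITAT (β) for ONE Greenberg field ⟸ `μ = 0` of its cyclotomic `ℤ₂`-tower**: for `W/ℚ` with `E[2]` reducible, an imaginary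
quadratic `K`, its cyclotomic `ℤ₂`-extension `κ` (topological generator `γ`) with `ClassicalMuVanishes κ`, `w ∣ 2`, and `Σ` finite containing the
bad places of `E_K` prime to `2`: every Pontryagin-dual datum of the Greenberg (strict at `w`, relaxed elsewhere above `2`) Selmer group of
`E_K[2^∞]` over `K_∞` is `Λ`-f.g., `Λ`-torsion, `μ = 0`. [cite: CastellaGrossiLeeSkinner2022, §1.4 Props. 17–18] [cite: Lang1990, Ch. 5 §4 pp. 137–143] -/
theorem greenbergStrictSelmerDual_finite_torsion_mu_on_beta_of_classicalMuVanishes (hred : ¬ W.HasIrreducibleModPGaloisRep 2)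
    {K : Type} [Field K] [NumberField K] (hK : IsImaginaryQuadratic K) (κ : ZpExtension K 2) (hκ : κ.IsCyclotomic)
    (hμ : ClassicalMuVanishes κ) {γ : absoluteGaloisGroup K} (hγ : κ.IsTopGenerator γ)
    {w : HeightOneSpectrum (𝓞 K)} (hw : ((2 : ℕ) : 𝓞 K) ∈ w.asIdeal)
    {S : Set (HeightOneSpectrum (𝓞 K))} (hSfin : S.Finite)
    (hS : ∀ v : HeightOneSpectrum (𝓞 K), v ∉ S → ((2 : ℕ) : 𝓞 K) ∉ v.asIdeal → (W.baseChange K).HasGoodReductionAt v)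
    (D : (W.baseChange K).GreenbergStrictSelmerDualData κ γ (AcSelmer.bdpData _ 2 w)) :
    Module.Finite (IwasawaAlgebra 2) D.X ∧ Module.IsTorsion (IwasawaAlgebra 2) D.X ∧ muInvariant 2 D.X = 0 := by
  haveI : Fact (Nat.Prime 2) := ⟨Nat.prime_two⟩
  obtain ⟨Φ, hΦ2⟩ := Summit.BirchSwinnertonDyer.BirchSwinnertonDyer.Theorems.TwoAdicTwoTorsionLine.stub_twoTorsionLineOverK W hred K
  have hR := residualGL1FinitenessAtTwo_of_classicalMuVanishes hK κ hκ hμ w hw S hSfin Φ.Sub hΦ2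
  exact greenbergStrictSelmerDual_finite_torsion_mu_of_residual_cyclotomic_two (W.baseChange K) κ hκ hγ hw hS Φ hΦ2 hR D

/-- **B2 ON HABITAT (β) ⟸ FW ALONE** (DICT discharged, `w̄`-step kernel). [cite: CastellaGrossiLeeSkinner2022, §1.4 Props. 17–18] [cite: FerreroWashington1979] -/
theorem greenbergStrictSelmerDual_finite_torsion_mu_on_beta_of_FW (hred : ¬ W.HasIrreducibleModPGaloisRep 2)
    (hFW : ferreroWashington1979_classicalMuVanishes)
    {K : Type} [Field K] [NumberField K] (hK : IsImaginaryQuadratic K) (κ : ZpExtension K 2) (hκ : κ.IsCyclotomic)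
    {γ : absoluteGaloisGroup K} (hγ : κ.IsTopGenerator γ)
    {w : HeightOneSpectrum (𝓞 K)} (hw : ((2 : ℕ) : 𝓞 K) ∈ w.asIdeal)
    {S : Set (HeightOneSpectrum (𝓞 K))} (hSfin : S.Finite)
    (hS : ∀ v : HeightOneSpectrum (𝓞 K), v ∉ S → ((2 : ℕ) : 𝓞 K) ∉ v.asIdeal → (W.baseChange K).HasGoodReductionAt v)
    (D : (W.baseChange K).GreenbergStrictSelmerDualData κ γ (AcSelmer.bdpData _ 2 w)) :
    Module.Finite (IwasawaAlgebra 2) D.X ∧ Module.IsTorsion (IwasawaAlgebra 2) D.X ∧ muInvariant 2 D.X = 0 :=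
  greenbergStrictSelmerDual_finite_torsion_mu_on_beta_of_classicalMuVanishes W hred hK κ hκ
    (classicalMuVanishes_imaginaryQuadratic_two_of_FW hFW hK κ hκ) hγ hw hSfin hS D

/-! ## §6 The skeleton's `greenbergSupply_of_stubs` conclusion -/

/-- **The Greenberg supply (skeleton v4.7 `greenbergSupply_of_stubs`, conclusion verbatim) ⟸ `μ₂ = 0` for every imaginary quadratic cyclotomic
tower** (Ferrero 1980 shape; the field is CHOSEN inside by `greenbergFieldPackage`): a Greenberg field `K` (Dirichlet), twist ordinarity at `2`,
`w ∣ 2`, the cyclotomic `ℤ₂`-extension with a topological generator, the two Pontryagin duals `X_Gr`, `X_fine`, and `X_Gr` finitely generated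
`Λ`-torsion with `μ = 0`. [cite: CastellaGrossiLeeSkinner2022, §1.4 Props. 17–18] [cite: Ferrero1980AJM, Thm. (μ = 0 for imaginary quadratic fields, p = 2)] -/
theorem greenbergSupply_of_imaginaryQuadraticMuVanishes [W.IsGloballyMinimal] (hGO : GoodOrd W 2) (hβ : ¬ W.HasIrreducibleModPGaloisRep 2)
    (hμ : ∀ (K : Type) [Field K] [NumberField K], IsImaginaryQuadratic K →
      ∀ (κK : ZpExtension K 2), κK.IsCyclotomic → ClassicalMuVanishes κK) :
    ∃ (K : Type) (_ : Field K) (_ : NumberField K),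
      (IsImaginaryQuadratic K ∧ SatisfiesHeegnerHypothesis (2 * W.conductorNorm ℤ) K) ∧
      (∀ (A : WeierstrassCurve ℚ) [A.IsElliptic] [A.IsGloballyMinimal] (C : VariableChange ℚ),
          C • A = W.quadraticTwist ((NumberField.discr K : ℤ) : ℚ) → IsOrdinaryAt A 2) ∧
      ∃ (w : HeightOneSpectrum (𝓞 K)) (_ : ((2 : ℕ) : 𝓞 K) ∈ w.asIdeal)
        (κK : ZpExtension K 2) (γK : absoluteGaloisGroup K),
        κK.IsCyclotomic ∧ κK.IsTopGenerator γK ∧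
        ∃ (DGr : (W.baseChange K).GreenbergStrictSelmerDualData κK γK (AcSelmer.bdpData (MK W K) 2 w))
          (_ : (W.baseChange K).GreenbergStrictSelmerDualData κK γK (fineData W K)),
          Module.Finite (IwasawaAlgebra 2) DGr.X ∧ Module.IsTorsion (IwasawaAlgebra 2) DGr.X ∧
            muInvariant 2 DGr.X = 0 := by
  haveI : Fact (Nat.Prime 2) := ⟨Nat.prime_two⟩
  obtain ⟨K, iF, iN, hK, hordTw, w, hw, κK, γK, hκK, hγK⟩ :=
    Summit.BirchSwinnertonDyer.BirchSwinnertonDyer.Theorems.TwoAdicGreenbergTwist.greenbergFieldPackage W hGO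
  let DGr := (W.baseChange K).greenbergStrictSelmerDualData κK (AcSelmer.bdpData (MK W K) 2 w) hγK
  let Dfi := (W.baseChange K).greenbergStrictSelmerDualData κK (fineData W K) hγK
  have hSfin : ((W.baseChange K).badPlaces (𝓞 K)).Finite :=
    (show ∀ [(W.baseChange K).IsElliptic], ((W.baseChange K).badPlaces (𝓞 K)).Finite from
      WeierstrassCurve.finite_badPlaces_holds (𝓞 K) (W.baseChange K))
  have hS : ∀ v : HeightOneSpectrum (𝓞 K), v ∉ (W.baseChange K).badPlaces (𝓞 K) →
      ((2 : ℕ) : 𝓞 K) ∉ v.asIdeal → (W.baseChange K).HasGoodReductionAt v := fun v hv _ => by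
    simpa [WeierstrassCurve.mem_badPlaces_iff] using hv
  have hcot := greenbergStrictSelmerDual_finite_torsion_mu_on_beta_of_classicalMuVanishes W hβ hK.1 κK hκK
    (hμ K hK.1 κK hκK) hγK hw hSfin hS DGr
  exact ⟨K, iF, iN, hK, hordTw, w, hw, κK, γK, hκK, hγK, DGr, Dfi, hcot⟩

/-- **The Greenberg supply ⟸ FW ALONE** (skeleton v4.7 `greenbergSupply_of_stubs`, conclusion verbatim; DICT discharged, `w̄`-step kernel).
[cite: CastellaGrossiLeeSkinner2022, §1.4 Props. 17–18] [cite: FerreroWashington1979] -/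
theorem greenbergSupply_of_FW [W.IsGloballyMinimal] (hGO : GoodOrd W 2) (hβ : ¬ W.HasIrreducibleModPGaloisRep 2)
    (hFW : ferreroWashington1979_classicalMuVanishes) :
    ∃ (K : Type) (_ : Field K) (_ : NumberField K),
      (IsImaginaryQuadratic K ∧ SatisfiesHeegnerHypothesis (2 * W.conductorNorm ℤ) K) ∧
      (∀ (A : WeierstrassCurve ℚ) [A.IsElliptic] [A.IsGloballyMinimal] (C : VariableChange ℚ),
          C • A = W.quadraticTwist ((NumberField.discr K : ℤ) : ℚ) → IsOrdinaryAt A 2) ∧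
      ∃ (w : HeightOneSpectrum (𝓞 K)) (_ : ((2 : ℕ) : 𝓞 K) ∈ w.asIdeal)
        (κK : ZpExtension K 2) (γK : absoluteGaloisGroup K),
        κK.IsCyclotomic ∧ κK.IsTopGenerator γK ∧
        ∃ (DGr : (W.baseChange K).GreenbergStrictSelmerDualData κK γK (AcSelmer.bdpData (MK W K) 2 w))
          (_ : (W.baseChange K).GreenbergStrictSelmerDualData κK γK (fineData W K)),
          Module.Finite (IwasawaAlgebra 2) DGr.X ∧ Module.IsTorsion (IwasawaAlgebra 2) DGr.X ∧
            muInvariant 2 DGr.X = 0 :=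
  greenbergSupply_of_imaginaryQuadraticMuVanishes W hGO hβ
    (fun _ _ _ hK κK hκK ↦ classicalMuVanishes_imaginaryQuadratic_two_of_FW hFW hK κK hκK)

end Summit.BirchSwinnertonDyer.BirchSwinnertonDyer.Theorems.TwoAdicGreenbergCotorsion

end
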